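import Summits.CriticalPhenomena.CardyFormulaZ2.Theorems.CardyComplexConeParafermionToSLESixFamiliesDiamondIdentifyMesh
import Summits.CriticalPhenomena.CardyFormulaZ2.Theorems.CardyComplexConeParafermionToSLESixFamiliesDiamondTraceStart
import HarnessLib

/-!
# The lattice layers of a straight diagonal side: carrier, discrete boundary and inner faces read off one
# integer (line `potential-darboux-picard-diamond`, S1″: the two-layer staircase)

Crux `ParafermionToSLESixFamilies` (stmt-CriticalPhenomena-11389), line `potential-darboux-picard-diamond`, stub
`stub_exactPotentialTracePh2` (S1″). Every lattice statement of the boundary trace (touch sites and their forced-closed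
edges, the block structure, the escape staircases of the winding, the connectivity of the discrete arcs) is read, near a
straight side of a marked diamond, off ONE integer-valued LAYER FUNCTION of the lattice: in the frame `e` of the side
(outward normal `re((· − c)e)` increasing, side line `re = α`) the tilted abscissa of the mesh point `δx` is
`(δ/√2) · layerFn j x + X₀` for the orientation `j` of the side's touch darts (`layerFn j` is `x₁ − x₀`, `−x₀ − x₁`,
`x₀ − x₁`, `x₀ + x₁` for `j = 0, 1, 2, 3`; the outward lattice directions are `u_{j+1}, u_{j+2}`). With `n` the last layer
inside (`(δ/√2) n + X₀ < α ≤ (δ/√2)(n+1) + X₀`) and for a site `x` in the bulk of the side (the other three sides more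
than `3δ` away in the frame), for data `E` on the open tilted rectangle read at mesh `δ` with every lattice point of the
rectangle in `Ω_δ` (`eventually_mem_meshDomain_of_isMarkedDiamond`):

* `mem_carrier_iff_layerFn_le` — a lattice point within `3δ` of `δx` lies in the carrier iff its layer is `≤ n`;
* `isInnerFace_faceAt_iff_layerFn` — the face `faceAt x (j + m)` is inner iff `layerFn j x + faceRise m ≤ n`
  (`faceRise = 1, 2, 1, 0`: the highest corner of the four faces around `x`);
* `touchRow_of_layerFn_eq` — a bulk site of layer `n − 2` is off the boundary, its two outward neighbours are
  boundary sites, its faces `j, j+1, j+2` are inner (the lattice half of the chain-sum hypotheses);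
  `layerFn_chainStep` — the chain step `x ↦ x − u_j − u_{j+1}` keeps the layer;
* `mem_zdBoundary_iff_layerFn` (registered, `--supports` the crux) — a site of the carrier is a discrete boundary site
  iff its layer is `n` or `n − 1`: **the discrete boundary along a straight diagonal side is the two-layer staircase**;
  the sites of layer `≤ n − 2` have four inner faces.

Frame-generic (the four sides of the diamond are the four frames `e = exp(-iπ/4)·ε`, `ε ∈ {1, −1, −i, i}`, with
`j = 3, 1, 0, 2`: `re_tilt_meshPoint_eq_layerFn`); elementary, nothing cited.
-/

noncomputable section

namespace Summit.CriticalPhenomena.CardyFormulaZ2.Cruxes.ParafermionToSLESixFamilies.PotentialDarbouxPicardDiamond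

open Set Metric Complex
open Literature.Probability Literature.Probability.LatticeModels Literature.Probability.Percolation
open Literature.Probability.LatticeModels.DiscreteDobrushin
open Literature.Probability.RandomPlanarGeometry
open Summit.CriticalPhenomena.CardyFormulaZ2.Cruxes.EdgePrecompact.QkzStripBoundaryArm
  (not_mem_zdBoundary_of_forall_isInnerFace)

/-! ## The layer function of an orientation -/

/-- The LAYER FUNCTION of the orientation `j`: the integer linear form on `ℤ²` increasing by `1` along the outward
directions `u_{j+1}, u_{j+2}` and decreasing by `1` along `u_j, u_{j+3}`. -/
def layerFn (j : Fin 4) (x : Site 2) : ℤ := ![x 1 - x 0, -(x 0 + x 1), x 0 - x 1, x 0 + x 1] j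

/-- The number of coordinates entering `layerFn j` with coefficient `+1` (the rise of the layer over a unit square
from its lower-left corner). -/
def layerTop (j : Fin 4) : ℤ := ![1, 0, 1, 2] j

/-- The rise of the layer over the face `faceAt x (j + m)` from its corner `x`: `1, 2, 1, 0`. -/
def faceRise (m : Fin 4) : ℤ := ![1, 2, 1, 0] m

/-- The layer function is additive. -/
theorem layerFn_add (j : Fin 4) (x y : Site 2) : layerFn j (x + y) = layerFn j x + layerFn j y := by
  fin_cases j <;> simp [layerFn] <;> ring

/-- The layer function of a difference. -/
theorem layerFn_sub (j : Fin 4) (x y : Site 2) : layerFn j (x - y) = layerFn j x - layerFn j y := by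
  fin_cases j <;> simp [layerFn] <;> ring

/-- The layer steps along the four lattice directions: `−1, +1, +1, −1` along `u_j, u_{j+1}, u_{j+2}, u_{j+3}`. -/
theorem layerFn_cornerUnit (j m : Fin 4) : layerFn j (cornerUnit (j + m)) = ![-1, 1, 1, -1] m := by
  revert j m; decide

/-- The layer of the `(j+m)`-th neighbour. -/
theorem layerFn_add_cornerUnit (j m : Fin 4) (x : Site 2) :
    layerFn j (x + cornerUnit (j + m)) = layerFn j x + ![-1, 1, 1, -1] m := by
  rw [layerFn_add, layerFn_cornerUnit]

/-- **The chain step keeps the layer**: `layerFn j (x − u_j − u_{j+1}) = layerFn j x`. -/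
theorem layerFn_chainStep (j : Fin 4) (x : Site 2) : layerFn j (x - cornerUnit j - cornerUnit (j + 1)) = layerFn j x := by
  have h0 := layerFn_cornerUnit j 0
  have h1 := layerFn_cornerUnit j 1
  simp only [add_zero, Matrix.cons_val_zero, Matrix.cons_val_one] at h0 h1
  rw [layerFn_sub, layerFn_sub, h0, h1]; ring

/-- The offset of the face `faceAt x (j + m)`: `layerTop j − layerFn j (cornerOff (j + m)) = faceRise m`. -/
theorem layerTop_sub_layerFn_cornerOff (j m : Fin 4) : layerTop j - layerFn j (cornerOff (j + m)) = faceRise m := by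
  revert j m; decide

/-- Corners of a face lie at most `layerTop j` above its lower-left corner. -/
theorem layerFn_le_of_isCorner (j : Fin 4) {v f : Site 2} (hv : IsCorner v f) : layerFn j v ≤ layerFn j f + layerTop j := by
  have h0 := hv 0
  have h1 := hv 1
  fin_cases j <;> simp [layerFn, layerTop] <;> omega

/-- Some corner of a face lies exactly `layerTop j` above its lower-left corner. -/
theorem exists_isCorner_layerFn_eq (j : Fin 4) (f : Site 2) : ∃ v : Site 2, IsCorner v f ∧ layerFn j v = layerFn j f + layerTop j := by
  fin_cases j
  · refine ⟨f + Pi.single 1 1, fun i => by fin_cases i <;> simp, ?_⟩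
    simp [layerFn, layerTop]; ring
  · exact ⟨f, isCorner_self f, by simp [layerFn, layerTop]⟩
  · refine ⟨f + Pi.single 0 1, fun i => by fin_cases i <;> simp, ?_⟩
    simp [layerFn, layerTop]; ring
  · refine ⟨f + Pi.single 0 1 + Pi.single 1 1, fun i => by fin_cases i <;> simp, ?_⟩
    simp [layerFn, layerTop]; ring

/-- **The highest corner of `faceAt x (j + m)`**: every corner has layer `≤ layerFn j x + faceRise m`, … -/
theorem layerFn_le_of_isCorner_faceAt (j m : Fin 4) {x v : Site 2} (hv : IsCorner v (faceAt x (j + m))) :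
    layerFn j v ≤ layerFn j x + faceRise m := by
  have h := layerFn_le_of_isCorner j hv
  rw [faceAt, layerFn_sub] at h
  have := layerTop_sub_layerFn_cornerOff j m
  linarith

/-- … and some corner attains it. -/
theorem exists_isCorner_faceAt_layerFn_eq (j m : Fin 4) (x : Site 2) :
    ∃ v : Site 2, IsCorner v (faceAt x (j + m)) ∧ layerFn j v = layerFn j x + faceRise m := by
  obtain ⟨v, hv, h⟩ := exists_isCorner_layerFn_eq j (faceAt x (j + m))
  refine ⟨v, hv, ?_⟩
  rw [h, faceAt, layerFn_sub]
  have := layerTop_sub_layerFn_cornerOff j m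
  linarith

/-- Every index is `j + m` for some `m`. -/
theorem exists_eq_add (j k : Fin 4) : ∃ m : Fin 4, k = j + m := ⟨k - j, by abel⟩

/-- The rises are at most `2`. -/
theorem faceRise_le_two (m : Fin 4) : faceRise m ≤ 2 := by fin_cases m <;> simp [faceRise]

/-! ## The tilted abscissa of mesh points in the four frames of the diamond -/

/-- **The four frames.** In the frames `e, −e, e·(−i), e·i` of the four sides (`e = exp(-iπ/4)`, as in
`eventually_exists_sideCell`), the tilted abscissa of the mesh point `δx` is `(δ/√2) · layerFn j x + X₀` with
`j = 3, 1, 0, 2` respectively and a constant `X₀`. -/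
theorem re_tilt_meshPoint_eq_layerFn (δ : ℝ) (c : ℂ) :
    (∀ x : Site 2, ((meshPoint δ x - c) * exp (-(Real.pi / 4 : ℝ) * I)).re =
        Real.sqrt 2 / 2 * δ * layerFn 3 x + -(Real.sqrt 2 / 2 * (c.re + c.im))) ∧
      (∀ x : Site 2, ((meshPoint δ x - c) * -exp (-(Real.pi / 4 : ℝ) * I)).re =
        Real.sqrt 2 / 2 * δ * layerFn 1 x + Real.sqrt 2 / 2 * (c.re + c.im)) ∧
      (∀ x : Site 2, ((meshPoint δ x - c) * (exp (-(Real.pi / 4 : ℝ) * I) * -I)).re =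
        Real.sqrt 2 / 2 * δ * layerFn 0 x + -(Real.sqrt 2 / 2 * (c.im - c.re))) ∧
      (∀ x : Site 2, ((meshPoint δ x - c) * (exp (-(Real.pi / 4 : ℝ) * I) * I)).re =
        Real.sqrt 2 / 2 * δ * layerFn 2 x + Real.sqrt 2 / 2 * (c.im - c.re)) := by
  refine ⟨fun x => ?_, fun x => ?_, fun x => ?_, fun x => ?_⟩
  · obtain ⟨h1, -⟩ := tilt_meshPoint δ c x
    rw [h1]; simp [layerFn]; ring
  · obtain ⟨h1, -⟩ := tilt_meshPoint δ c x
    rw [mul_neg, neg_re, h1]; simp [layerFn]; ring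
  · obtain ⟨-, h2⟩ := tilt_meshPoint δ c x
    rw [← mul_assoc, mul_neg, neg_re, mul_I_re, neg_neg, h2]; simp [layerFn]; ring
  · obtain ⟨-, h2⟩ := tilt_meshPoint δ c x
    rw [← mul_assoc, mul_I_re, h2]; simp [layerFn]; ring

/-! ## The frame of a side -/

section Frame

variable {c e : ℂ} (he : ‖e‖ = 1) {α β δ : ℝ} (hδ : 0 < δ) {E : DiscreteDobrushin}
  (hΩ : E.Ω = {z : ℂ | |((z - c) * e).re| < α ∧ |((z - c) * e).im| < β}) (hEδ : E.δ = δ)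
  (hgood : ∀ x : Site 2, meshPoint δ x ∈ E.Ω → x ∈ meshDomain E.Ω δ)
  {j : Fin 4} {X₀ : ℝ} (hX : ∀ x : Site 2, ((meshPoint δ x - c) * e).re = Real.sqrt 2 / 2 * δ * layerFn j x + X₀)
  {n : ℤ} (hn : Real.sqrt 2 / 2 * δ * n + X₀ < α) (hn' : α ≤ Real.sqrt 2 / 2 * δ * (n + 1) + X₀)
  {x : Site 2} (hxY : |((meshPoint δ x - c) * e).im| + 3 * δ < β) (hxX : -α + 3 * δ < ((meshPoint δ x - c) * e).re)

include he hΩ hδ hX hn hn' hxY hxX in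
/-- **Carrier membership near `x` is read off the layer**: a lattice point within `3δ` of `δx` lies in the carrier
iff its layer is at most `n` (in the bulk of the side only the constraint `re < α` is active). -/
theorem mem_carrier_iff_layerFn_le {y : Site 2} (hy : ‖meshPoint δ y - meshPoint δ x‖ ≤ 3 * δ) :
    meshPoint δ y ∈ E.Ω ↔ layerFn j y ≤ n := by
  have hpos : 0 < Real.sqrt 2 / 2 * δ := by positivity
  have hXy := abs_le.1 ((abs_re_tilt_sub_le c e he (meshPoint δ y) (meshPoint δ x)).trans hy)
  have hYy := abs_le.1 ((abs_im_tilt_sub_le c e he (meshPoint δ y) (meshPoint δ x)).trans hy)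
  have hxY' := (abs_add_three_lt hxY)
  rw [hΩ, mem_setOf_eq]
  constructor
  · rintro ⟨h1, -⟩
    have h1' := (abs_lt.1 h1).2
    rw [hX y] at h1'
    by_contra hlt
    push Not at hlt
    have : (n : ℝ) + 1 ≤ (layerFn j y : ℝ) := by exact_mod_cast hlt
    nlinarith
  · intro hle
    have hle' : (layerFn j y : ℝ) ≤ n := by exact_mod_cast hle
    refine ⟨abs_lt.2 ⟨by linarith, ?_⟩, abs_lt.2 ⟨by linarith [hxY'.1], by linarith [hxY'.2]⟩⟩
    rw [hX y]; nlinarith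
  where
  /-- `|a| + 3δ < β` unfolded. -/
  abs_add_three_lt {a : ℝ} (h : |a| + 3 * δ < β) : -β + 3 * δ < a ∧ a + 3 * δ < β := by
    constructor <;> cases abs_lt.1 (show |a| < β - 3 * δ by linarith) <;> linarith

include he hΩ hδ hX hn hn' hxY hxX in
/-- Carrier membership of the points of the `3 × 3` block around `x`. -/
theorem mem_carrier_iff_layerFn_le_of_block {y : Site 2} (hy : ∀ i, |y i - x i| ≤ 1) :
    meshPoint δ y ∈ E.Ω ↔ layerFn j y ≤ n := by
  refine mem_carrier_iff_layerFn_le he hδ hΩ hX hn hn' hxY hxX ((norm_meshPoint_sub_le_of_block hδ.le hy).trans ?_)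
  have hs2 : Real.sqrt 2 < 3 / 2 := by rw [Real.sqrt_lt' (by norm_num)]; norm_num
  nlinarith

include he hΩ hδ hX hn hn' hxY hxX in
/-- The site `x` itself: in the carrier iff `layerFn j x ≤ n`. -/
theorem mem_carrier_iff_layerFn_le_self : meshPoint δ x ∈ E.Ω ↔ layerFn j x ≤ n :=
  mem_carrier_iff_layerFn_le he hδ hΩ hX hn hn' hxY hxX (by rw [sub_self, norm_zero]; positivity)

include he hΩ hδ hX hn hn' hxY hxX hgood in
/-- Membership in the discrete domain `Ω_δ` of the block around `x` is read off the layer too. -/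
theorem mem_meshDomain_iff_layerFn_le_of_block {y : Site 2} (hy : ∀ i, |y i - x i| ≤ 1) :
    y ∈ meshDomain E.Ω δ ↔ layerFn j y ≤ n := by
  rw [← mem_carrier_iff_layerFn_le_of_block he hδ hΩ hX hn hn' hxY hxX hy]
  exact ⟨fun h => meshDomain_subset_meshVertices _ _ h, hgood y⟩

include he hΩ hδ hX hn hn' hxY hxX hgood hEδ in
/-- **Inner faces around `x` are read off the layer**: `faceAt x (j + m)` is inner iff its highest corner is inside,
`layerFn j x + faceRise m ≤ n`. -/
theorem isInnerFace_faceAt_iff_layerFn (m : Fin 4) : E.IsInnerFace (faceAt x (j + m)) ↔ layerFn j x + faceRise m ≤ n := by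
  constructor
  · intro hf
    obtain ⟨v, hv, hvL⟩ := exists_isCorner_faceAt_layerFn_eq j m x
    have hmem := corner_mem_of_isInnerFace hf hv
    rw [hEδ] at hmem
    have hblk : ∀ i, |v i - x i| ≤ 1 := abs_sub_le_one_of_isCorner (isCorner_faceAt x (j + m)) hv
    rw [← hvL]
    exact (mem_carrier_iff_layerFn_le_of_block he hδ hΩ hX hn hn' hxY hxX hblk).1 hmem
  · intro hle
    have hconv : Convex ℝ E.Ω := by rw [hΩ]; exact convex_tiltedBox c e α β
    refine isInnerFace_of_forall_corner_mem hconv hgood rfl hEδ fun v hv => ?_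
    have hblk : ∀ i, |v i - x i| ≤ 1 := abs_sub_le_one_of_isCorner (isCorner_faceAt x (j + m)) hv
    exact (mem_carrier_iff_layerFn_le_of_block he hδ hΩ hX hn hn' hxY hxX hblk).2
      ((layerFn_le_of_isCorner_faceAt j m hv).trans hle)

include he hΩ hδ hX hn hn' hxY hxX hgood hEδ in
/-- Sites of layer `≤ n − 2` have four inner faces. -/
theorem isInnerFace_faceAt_of_layerFn_le (hle : layerFn j x + 2 ≤ n) (k : Fin 4) : E.IsInnerFace (faceAt x k) := by
  obtain ⟨m, rfl⟩ := exists_eq_add j k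
  exact (isInnerFace_faceAt_iff_layerFn he hδ hΩ hEδ hgood hX hn hn' hxY hxX m).2
    (by linarith [faceRise_le_two m])

include he hΩ hδ hX hn hn' hxY hxX hgood hEδ in
/-- **The discrete boundary along a straight side is the two-layer staircase**: a site of the carrier in the bulk of
the side is a discrete boundary site of `E` iff its layer is `n` or `n − 1`. (Layer `n`: the edge `u_j` is targeted at
`x` — face `j + 3` inner, face `j` not; layer `n − 1`: the edge `u_{j+1}` is — face `j` inner, face `j + 1` not; layer
`≤ n − 2`: four inner faces.) -/
theorem mem_zdBoundary_iff_layerFn' (hxin : meshPoint δ x ∈ E.Ω) : x ∈ E.zdBoundary ↔ n - 1 ≤ layerFn j x := by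
  have hxn : layerFn j x ≤ n := (mem_carrier_iff_layerFn_le_self he hδ hΩ hX hn hn' hxY hxX).1 hxin
  have hface := isInnerFace_faceAt_iff_layerFn he hδ hΩ hEδ hgood hX hn hn' hxY hxX (x := x)
  constructor
  · intro hb
    by_contra hlt
    push Not at hlt
    exact not_mem_zdBoundary_of_forall_isInnerFace
      (isInnerFace_faceAt_of_layerFn_le he hδ hΩ hEδ hgood hX hn hn' hxY hxX (by omega)) hb
  · intro hge
    rcases (show layerFn j x = n - 1 ∨ layerFn j x = n by omega) with h | h
    · -- layer `n - 1`: `IsInEdge x (j + 1)`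
      refine mem_zdBoundary_of_isInEdge (k := j + 1) ⟨?_, ?_⟩
      · rw [fin4_add_one_add_three]
        have := (hface 0).2 (by simp [faceRise]; omega)
        simpa using this
      · intro hf
        have := (hface 1).1 hf
        simp [faceRise] at this
        omega
    · -- layer `n`: `IsInEdge x j`
      refine mem_zdBoundary_of_isInEdge (k := j) ⟨(hface 3).2 (by simp [faceRise]; omega), ?_⟩
      intro hf
      have := (hface 0).1 (by simpa using hf)
      simp [faceRise] at this
      omega

include he hΩ hδ hX hn hn' hxY hxX hgood hEδ in
/-- **The touch row.** A bulk site of layer `n − 2` is off the discrete boundary, its two outward neighbours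
`x + u_{j+1}`, `x + u_{j+2}` (layer `n − 1`; assumed in the bulk too) are discrete boundary sites, and the faces
`j, j + 1, j + 2` at `x` are inner — the lattice half of the hypotheses of the block / chain-sum lemmas
(`exactPair_chainSum_touchProb`), the arc half being `zdBoundary ⊆ A ∪ B` and `eventually_arcs_near_freeSegment`. -/
theorem touchRow_of_layerFn_eq (hL : layerFn j x = n - 2)
    (h₁Y : |((meshPoint δ (x + cornerUnit (j + 1)) - c) * e).im| + 3 * δ < β)
    (h₁X : -α + 3 * δ < ((meshPoint δ (x + cornerUnit (j + 1)) - c) * e).re)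
    (h₂Y : |((meshPoint δ (x + cornerUnit (j + 2)) - c) * e).im| + 3 * δ < β)
    (h₂X : -α + 3 * δ < ((meshPoint δ (x + cornerUnit (j + 2)) - c) * e).re) :
    x ∉ E.zdBoundary ∧ x + cornerUnit (j + 1) ∈ E.zdBoundary ∧ x + cornerUnit (j + 2) ∈ E.zdBoundary ∧
      E.IsInnerFace (faceAt x j) ∧ E.IsInnerFace (faceAt x (j + 1)) ∧ E.IsInnerFace (faceAt x (j + 2)) := by
  have hL₁ : layerFn j (x + cornerUnit (j + 1)) = n - 1 := by
    rw [layerFn_add_cornerUnit]; simp only [Matrix.cons_val_one, Matrix.cons_val_zero]; omega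
  have hL₂ : layerFn j (x + cornerUnit (j + 2)) = n - 1 := by
    rw [layerFn_add_cornerUnit]; simp only [Matrix.cons_val]; omega
  have hxin : meshPoint δ x ∈ E.Ω := (mem_carrier_iff_layerFn_le_self he hδ hΩ hX hn hn' hxY hxX).2 (by omega)
  have h₁in : meshPoint δ (x + cornerUnit (j + 1)) ∈ E.Ω :=
    (mem_carrier_iff_layerFn_le_self he hδ hΩ hX hn hn' h₁Y h₁X).2 (by omega)
  have h₂in : meshPoint δ (x + cornerUnit (j + 2)) ∈ E.Ω :=
    (mem_carrier_iff_layerFn_le_self he hδ hΩ hX hn hn' h₂Y h₂X).2 (by omega)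
  have hface := isInnerFace_faceAt_iff_layerFn he hδ hΩ hEδ hgood hX hn hn' hxY hxX (x := x)
  refine ⟨fun hb => ?_, (mem_zdBoundary_iff_layerFn' he hδ hΩ hEδ hgood hX hn hn' h₁Y h₁X h₁in).2 (by omega),
    (mem_zdBoundary_iff_layerFn' he hδ hΩ hEδ hgood hX hn hn' h₂Y h₂X h₂in).2 (by omega), ?_, ?_, ?_⟩
  · have := (mem_zdBoundary_iff_layerFn' he hδ hΩ hEδ hgood hX hn hn' hxY hxX hxin).1 hb
    omega
  · simpa using (hface 0).2 (by simp [faceRise]; omega)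
  · exact (hface 1).2 (by simp [faceRise]; omega)
  · exact (hface 2).2 (by simp [faceRise]; omega)

end Frame

/-- **The two-layer staircase** (registered helper of `stub_exactPotentialTracePh2`, frame form). Let `E` be a datum on
the open tilted rectangle `{|re((z−c)e)| < α, |im((z−c)e)| < β}` (`‖e‖ = 1`) read at its mesh `δ > 0`, with every
lattice point of the rectangle in `Ω_δ`; let the tilted abscissa of mesh points be `(δ/√2)·layerFn j + X₀` and `n` the
last layer inside (`(δ/√2) n + X₀ < α ≤ (δ/√2)(n+1) + X₀`). Then for every lattice point `x` of the rectangle in the bulk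
of the side `re = α` (`|im| + 3δ < β`, `re > −α + 3δ` at `δx`): `x ∈ E.zdBoundary ↔ n − 1 ≤ layerFn j x` (and
`layerFn j x ≤ n`), every face `faceAt x (j + m)` being inner iff `layerFn j x + faceRise m ≤ n`. -/
theorem mem_zdBoundary_iff_layerFn : ∀ (c e : ℂ), ‖e‖ = 1 → ∀ (α β δ : ℝ), 0 < δ → ∀ (E : DiscreteDobrushin), E.Ω = {z : ℂ | |((z - c) * e).re| < α ∧ |((z - c) * e).im| < β} → E.δ = δ → (∀ x : Site 2, meshPoint δ x ∈ E.Ω → x ∈ meshDomain E.Ω δ) → ∀ (j : Fin 4) (X₀ : ℝ), (∀ x : Site 2, ((meshPoint δ x - c) * e).re = Real.sqrt 2 / 2 * δ * layerFn j x + X₀) → ∀ (n : ℤ), Real.sqrt 2 / 2 * δ * n + X₀ < α → α ≤ Real.sqrt 2 / 2 * δ * (n + 1) + X₀ → ∀ x : Site 2, |((meshPoint δ x - c) * e).im| + 3 * δ < β → -α + 3 * δ < ((meshPoint δ x - c) * e).re → meshPoint δ x ∈ E.Ω → (x ∈ E.zdBoundary ↔ n - 1 ≤ layerFn j x) ∧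 layerFn j x ≤ n ∧ ∀ m : Fin 4, E.IsInnerFace (faceAt x (j + m)) ↔ layerFn j x + faceRise m ≤ n := by
  intro c e he α β δ hδ E hΩ hEδ hgood j X₀ hX n hn hn' x hxY hxX hxin
  exact ⟨mem_zdBoundary_iff_layerFn' he hδ hΩ hEδ hgood hX hn hn' hxY hxX hxin,
    (mem_carrier_iff_layerFn_le_self he hδ hΩ hX hn hn' hxY hxX).1 hxin,
    fun m => isInnerFace_faceAt_iff_layerFn he hδ hΩ hEδ hgood hX hn hn' hxY hxX m⟩

end Summit.CriticalPhenomena.CardyFormulaZ2.Cruxes.ParafermionToSLESixFamilies.PotentialDarbouxPicardDiamond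

end
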